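import Summits.QuantumFields.YangMills.Theorems.BalabanUVNodesN15TwoSpacingGluingNeumannRemainder
import HarnessLib

/-!
# Route «BalabanUVNodes» (K3⁸ `SpineGivenEndpointR13SepCoPHV`, stmt-QuantumFields-27366), node N15 = NE2, -a lane, PROGRAMME N file N-IIt: THE TAIL ROWS OF THE DRESSED SMOOTH-CUT
# CUBE — `(−M_h∘N_L∘M_{1−χ̃})∘G(□ + c) ≤ 1_□(y)1_□(y′)·ε₀·e^{−ρ|y−y′|_T}` with `ε₀` EXPONENTIALLY SMALL IN THE MARGIN between the partition function `h` and the collar of the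
# bump `χ̃` (dag-n15-w3 g4's located row (r1): the `hT ∕ hT′` hypotheses of `…CurvedGluingSmoothCutDressedGlued(Defect)`, files 44∕45, for this lane's images-extended Neumann cubes)

Cell `pub-ymgap`, seat `pub-ymgap-dag-n15-a` (KNIT-BY-NAME, g23; HUMAN RULING D-0062; chair R424 venue; `bears_on: R4∕N15`).  Filed `--kind proof --supports stmt-QuantumFields-27366
--as helper` — COUNT-NEUTRAL.  Theorems only (0 `def`, 0 `sorry`).  Imports BY NAME dag-n15-c FILE 69 `…TwoSpacingGluingNeumannRemainder` (`hasMaj_nonlocalPart`: the letter of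
`N_L = aQ*Q − ∂Π∂*`; through it FILE 68 `…CutRowsMargin` (the far-sandwich mechanism), FILE 59 `…TwoSpacingGluingCubes` (`hasMaj_diag_comp`, `hasMaj_comp_diag`), `…PartitionSupport`
(`mulOp_comp_mulOp_of_support`), this lane's N-IIi `…NeumannCubeConvolution` (`hasMaj_chiCube_comp_neumannCubeG`), parts 39∕42∕47 (`hasMaj_gOp_of_ineq`, `ineq110_114_pair`, `hasMaj_landauRe`));
nothing in the tree is modified.

WHY.  dag-n15-w3's dressed smooth-cut cube `X_□` (files 31–45 of `…N15.CurvedSpecies`) inverts the live-background operator against its partition function only modulo the TAIL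
`T_□ := (−M_h∘N_L∘M_{1−χ̃})∘N_□` (file 33 `mulOp_comp_sub_comp_dressedV_tail`): the local part of `Δ_U` cannot cross the collar where the bump `χ̃ ≡ 1`, but Bałaban's nonlocal summand
`N_L = aQ*Q − ∂Π∂*` of `Δ_a` ([B5] (1.69), (1.120)–(1.123): the `P(dh)` phenomenon) reaches from `supp h` across the collar.  Files 44∕45 (and g5's gauged capstones) DISPLAY its rows
`hT ∕ hT′ : T_□ ≤ 1_S1_S·ε₀e^{−ρ_Td}` with the note «images geometry ∕ FILE 68 far sandwich — NOT typed for the bump (r1), producer dag-n15-a».  THIS FILE types them for this lane's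
images-extended Neumann cube `N_□ = G(□ + c) = Sym∘G∘χ°` (N-IIIa) at ANY spacing: the sandwich `M_h∘N_L∘M_{1−χ̃}` is exponentially small in the block distance `gap` between the blocks
carrying `h` and the blocks off the bump's plateau (FILE 68's far sandwich, mirrored and output-localized, §1–§2), and behind the cube propagator the method of images costs `2^{d+1}e^{δ₀}c_r`
with the mirror images farther than the source under the output cut `M_h = M_{χ_□}M_h` (N-IIi, §3); §4 discharges both analytic letters on the lineage's doubled tori at BOTH spacings.

WHAT.
* §1 ★ `hasMaj_far_sandwich_out` — GENERIC, two carriers, bounded weights: `|h| ≤ k_h` vanishing off the blocks of `H`, `|ψ| ≤ k_ψ` vanishing on the blocks of `A` (`ψ = 1 − χ̃`: the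
  bump's collar, `A` its plateau), `d(y, y′) ≥ gap` for `y ∈ H`, `y′ ∉ A`, `T ≤ c·e^{−δd}` ⟹ `M_h∘T∘M_ψ ≤ 1_H(y)·k_h c k_ψ·e^{−(δ−ρ₁)gap}·e^{−ρ₁d}` (`ρ₁ ≤ δ`) — reused by the sequel
  for the three terms of the tail's η-defect;
* §2 ★★ `hasMaj_tailSandwich` — any torus ∕ spacing: `M_h∘(aQ*Q − ∂Π∂*)∘M_ψ ≤ 1_H(y)·c_N e^{−(δ_N−ρ₁)gap}·e^{−ρ₁d}`, `c_N = |a|e^{2δ_N} + C₁` (`|h|, |ψ| ≤ 1`; `∂Π∂* ≤ C₁e^{−δ₁d}` displayed);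
* §3 `mulOp_chiCube_comp_mulOp` (`M_{χ_□}M_h = M_h` when `H ⊆` the cube's blocks), ★★★ `hasMaj_tail_neumannCubeG` — doubled-cube torus `M_ν = 2S`, ANY spacing `n` (serves `hT` AND `hT′`):
  `(−M_h∘N_L∘M_ψ)∘G(□ + c) ≤ 1_□(y)1_□(y′)·ε₀·e^{−ρ|y−y′|_T}`, `ε₀ = 2^{d+1}·c_N e^{−(δ_N−ρ₁)gap}·Ce^{δ₀}·c_r` — EXPONENTIALLY SMALL IN THE MARGIN (`G ≤ Ce^{−δ₀d}`, `∂Π∂* ≤ C₁e^{−δ₁d}`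
  displayed; `ρ ≤ δ₀`, `ρ + σ ≤ ρ₁ ≤ δ_N ≤ δ₁`);
* §4 ★★★ `hasMaj_tail_neumannCubeG_pair` — the lineage's doubled tori `M_ν = 2L^{m_T} = 2S` (cube side `S` in any spelling), spacings `L^k` AND `L^r·L^k`, BOTH analytic letters DISCHARGED ([B5] Prop. 1.2
  (1.110) at `U ≡ 1` via `ineq110_114_pair` + `hasMaj_gOp_of_ineq`; (1.126) via `hasMaj_landauRe`): `∃ δ_T δ_g c_T > 0` such that for EVERY `m_T, k ≥ 1, r, c` and EVERY `h, χ̃, H, A, gap` with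
  the support ∕ plateau ∕ gap hypotheses the tail is `≤ 1_□1_□·c_T e^{−δ_g·gap}·e^{−δ_T d}` at both spacings — HYPOTHESIS-FREE in every analytic letter; `h, χ̃, H, A, gap` stay generic
  (dag-n15-c's cover partition `hcube` (FILE 67) and the bump instance (r2) plug in unchanged).

HONEST FRAMING ∕ LIMITS.  Block-majorant bookkeeping over LANDED letters; no new analytic estimate; `U ≡ 1` doubled-cube torus MODEL (one-cube model; ref-B OBSERVATION-2 ∕ CAUTION-P (4));
[B5] (1.69) p.29, (1.120)–(1.123) p.37, (1.126) p.38 ∕ [B6] (2.36)–(2.37) p.229, (2.92)–(2.93) p.239, (2.133)–(2.134) p.247 ∕ [B9] (3.63)–(3.65) pp.402–403 = SHAPES ∕ MECHANISM, nothing of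
[B5]∕[B6]∕[B9] asserted; NE2⁺ NOT PRINTED ∕ NOT proved; N15 NOT discharged; K3⁸ OPEN, skeleton v6 untouched; counts of record UNMOVED (typed 28∕28 · discharged 5∕27); one finite 𝕋⁴ at
fixed ε — NOT infinite volume, NOT OS on ℝ⁴, NOT a mass gap, NOT Clay; R4 closes the conditional finite-𝕋⁴ rung `BalabanLadder.UV` only.  Restate-immune (no Theses import).
-/

noncomputable section

open scoped BigOperators
open Finset

namespace Summit.QuantumFields.YangMills.BalabanUVNodes.N15.TwoGrid

open Literature.MathematicalPhysics.QuantumFieldTheory.Balaban1983to89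
open Literature.MathematicalPhysics.QuantumFieldTheory.Balaban1983to89.B5Prop11Plancherel (Tor fine)
open Literature.MathematicalPhysics.QuantumFieldTheory.Balaban1983to89.B6Prop26Gluing (mulOp mulOp_apply ind ind_nonneg ind_le_one)
open Literature.MathematicalPhysics.QuantumFieldTheory.King1986.Torus (blockOf tdistT tdistT_nonneg)
open Literature.MathematicalPhysics.QuantumFieldTheory.Balaban1983to89.B11SectG (BlockNorm HasMaj RowSum)
open Literature.MathematicalPhysics.QuantumFieldTheory.Balaban1983to89.B6UnitTorusCarrier (unitTorusGeo triangle254_unitTorusGeo rowSum_unitTorusGeo)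
open Literature.MathematicalPhysics.QuantumFieldTheory.Balaban1983to89.B6RandomWalk (Triangle254)
open Literature.MathematicalPhysics.QuantumFieldTheory.Balaban1983to89.T4EtaRateCoeffDefect (diagK diagK_nonneg hasMaj_mulOp)
open Literature.MathematicalPhysics.QuantumFieldTheory.Balaban1983to89.B5SiteBridgeP12 (MP)
open Summit.QuantumFields.YangMills.BalabanUVNodes.N15.VectorPiece (blkFine)
open Summit.QuantumFields.YangMills.BalabanUVNodes.N15.Gluing (hasMaj_diag_comp hasMaj_comp_diag hasMaj_nonlocalPart mulOp_comp_mulOp_of_support mulOp_comp_mulOp_comm)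

variable {d : ℕ}

/-! ## §1 The far sandwich, mirrored and output-localized (generic carrier) -/

section Far

variable {X X' : Type} [Fintype X] [Fintype X'] {g : B6.Geometry} (blk : X → g.Site) (blk' : X' → g.Site)

/-- ★ **THE FAR SANDWICH OF THE TAIL** (FILE 68 `hasMaj_far_sandwich` with the roles of the two multipliers exchanged, output localization kept, two carriers, bounded weights):
`T ≤ c·e^{−δd}` from the `blk`-carrier to the `blk′`-carrier, an output weight `|h| ≤ k_h` vanishing off the blocks of `H`, an input weight `|ψ| ≤ k_ψ` vanishing on the blocks of `A`
(for the dressed smooth-cut cube: `h` the partition function, `ψ = 1 − χ̃` the collar of the bump, `A` its plateau), and `d(y, y′) ≥ gap` whenever `y ∈ H`, `y′ ∉ A` ⟹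
`M_h∘T∘M_ψ ≤ 1_H(y)·k_h c k_ψ·e^{−(δ−ρ₁)gap}·e^{−ρ₁d}` (`ρ₁ ≤ δ`). [cite: Balaban1984PropagatorsII, p.239 («ζ_□ … distance ⅓M to the boundary of □»: mechanism); Balaban1984PropagatorsI, (1.120)–(1.123) p.37 (the nonlocal tail: shape)] -/
theorem hasMaj_far_sandwich_out {T : (X → ℝ) →ₗ[ℝ] (X' → ℝ)} {h : X' → ℝ} {ψ : X → ℝ} {H A : Set g.Site} {c δ ρ₁ gap kh kψ : ℝ} (hc : 0 ≤ c) (hρδ : ρ₁ ≤ δ)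
    (hkh : 0 ≤ kh) (hkψ : 0 ≤ kψ) (hh1 : ∀ x, |h x| ≤ kh) (hhH : ∀ x, blk' x ∉ H → h x = 0) (hψ1 : ∀ x, |ψ x| ≤ kψ) (hψA : ∀ x, blk x ∈ A → ψ x = 0)
    (hgap : ∀ y y', y ∈ H → y' ∉ A → gap ≤ g.dist y y')
    (hT : HasMaj (BlockNorm.ofBlocks g blk) (BlockNorm.ofBlocks g blk') T (fun y y' => c * Real.exp (-(δ * g.dist y y')))) :
    HasMaj (BlockNorm.ofBlocks g blk) (BlockNorm.ofBlocks g blk') (mulOp h ∘ₗ T ∘ₗ mulOp ψ)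
      (fun y y' => ind H y * (kh * c * kψ * Real.exp (-((δ - ρ₁) * gap)) * Real.exp (-(ρ₁ * g.dist y y')))) := by
  classical
  have hMh := hasMaj_mulOp (g := g) blk' (a := h) (m := fun y => kh * ind H y) (fun y => mul_nonneg hkh (ind_nonneg _ _)) fun x => by
    by_cases hx : blk' x ∈ H
    · unfold ind; rw [if_pos hx, mul_one]; exact hh1 x
    · rw [hhH x hx, abs_zero]; exact mul_nonneg hkh (ind_nonneg _ _)
  have hMχ := hasMaj_mulOp (g := g) blk (a := ψ) (m := fun y => kψ * ind Aᶜ y) (fun y => mul_nonneg hkψ (ind_nonneg _ _)) fun x => by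
    by_cases hx : blk x ∈ A
    · rw [hψA x hx, abs_zero]; exact mul_nonneg hkψ (ind_nonneg _ _)
    · unfold ind; rw [if_pos (Set.mem_compl hx), mul_one]; exact hψ1 x
  have h1 := hasMaj_comp_diag blk (fun y y' => mul_nonneg hc (Real.exp_nonneg _)) hT hMχ
  have h2 := hasMaj_diag_comp blk' (fun y => mul_nonneg hkh (ind_nonneg H y)) hMh h1
  refine h2.mono fun y y' => ?_
  by_cases hy : y ∈ H
  · by_cases hy' : y' ∈ A
    · have h0 : ind Aᶜ y' = 0 := by unfold ind; rw [if_neg (fun h => h hy')]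
      have hz : kh * ind H y * (c * Real.exp (-(δ * g.dist y y')) * (kψ * ind Aᶜ y')) = 0 := by rw [h0]; ring
      rw [hz]
      exact mul_nonneg (ind_nonneg _ _) (by positivity)
    · have hg := hgap y y' hy hy'
      have hiA : ind Aᶜ y' = 1 := by unfold ind; rw [if_pos (Set.mem_compl hy')]
      have hiH : ind H y = 1 := by unfold ind; rw [if_pos hy]
      have hexp : Real.exp (-(δ * g.dist y y')) ≤ Real.exp (-((δ - ρ₁) * gap)) * Real.exp (-(ρ₁ * g.dist y y')) := by
        rw [← Real.exp_add]; exact Real.exp_le_exp.mpr (by nlinarith)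
      calc kh * ind H y * (c * Real.exp (-(δ * g.dist y y')) * (kψ * ind Aᶜ y')) = kh * c * kψ * Real.exp (-(δ * g.dist y y')) := by rw [hiA, hiH]; ring
        _ ≤ kh * c * kψ * (Real.exp (-((δ - ρ₁) * gap)) * Real.exp (-(ρ₁ * g.dist y y'))) := mul_le_mul_of_nonneg_left hexp (by positivity)
        _ = ind H y * (kh * c * kψ * Real.exp (-((δ - ρ₁) * gap)) * Real.exp (-(ρ₁ * g.dist y y'))) := by rw [hiH]; ring
  · have h0 : ind H y = 0 := by unfold ind; rw [if_neg hy]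
    have hz : kh * ind H y * (c * Real.exp (-(δ * g.dist y y')) * (kψ * ind Aᶜ y')) = 0 := by rw [h0]; ring
    rw [hz, h0, zero_mul]

end Far

/-! ## §2 The tail's sandwich `M_h∘(aQ*Q − ∂Π∂*)∘M_{1−χ̃}` on the unit-block torus carrier -/

section Tail

variable {L : ℕ} {M : Fin (d + 1) → ℕ} [∀ μ, NeZero (M μ)] {k n : ℕ} [NeZero n]

/-- ★★ **THE TAIL's SANDWICH IS EXPONENTIALLY SMALL IN THE MARGIN**: `∂Π∂* ≤ C₁e^{−δ₁d}`, `0 ≤ δ_N ≤ δ₁`, `ρ₁ ≤ δ_N`, `|h| ≤ 1` vanishing off the blocks of `H`, `|1 − χ̃| ≤ 1`, `χ̃ = 1` on the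
blocks of `A`, `|y − y′|_T ≥ gap` for `y ∈ H`, `y′ ∉ A` ⟹ `M_h∘(aQ*Q − ∂Π∂*)∘M_{1−χ̃} ≤ 1_H(y)·(|a|e^{2δ_N} + C₁)e^{−(δ_N−ρ₁)gap}·e^{−ρ₁|y−y′|_T}` (FILE 69 `hasMaj_nonlocalPart` behind §1).
[cite: Balaban1984PropagatorsI, (1.69) p.29, (1.120)–(1.123) p.37, (1.126) p.38 (shapes); Balaban1984PropagatorsII, (2.92)–(2.93) p.239 (mechanism)] -/
theorem hasMaj_tailSandwich {a C₁ δ₁ δN ρ₁ gap : ℝ} (hC₁ : 0 ≤ C₁) (hδN : 0 ≤ δN) (hδ : δN ≤ δ₁) (hρ₁ : ρ₁ ≤ δN)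
    (hNL : HasMaj (BlockNorm.ofBlocks (unitTorusGeo L k M) (fun b : Tor (fine n M) × Fin (d + 1) => blockOf n M b.1))
      (BlockNorm.ofBlocks (unitTorusGeo L k M) (fun b : Tor (fine n M) × Fin (d + 1) => blockOf n M b.1)) (landauRe M n) (fun y y' => C₁ * Real.exp (-(δ₁ * tdistT M y y'))))
    {h ψ : Tor (fine n M) × Fin (d + 1) → ℝ} {H A : Set (Tor M)}
    (hh1 : ∀ x, |h x| ≤ 1) (hhH : ∀ x, blockOf n M x.1 ∉ H → h x = 0) (hψ1 : ∀ x, |ψ x| ≤ 1) (hψA : ∀ x, blockOf n M x.1 ∈ A → ψ x = 0)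
    (hgap : ∀ y y', y ∈ H → y' ∉ A → gap ≤ tdistT M y y') :
    HasMaj (BlockNorm.ofBlocks (unitTorusGeo L k M) (fun b : Tor (fine n M) × Fin (d + 1) => blockOf n M b.1))
      (BlockNorm.ofBlocks (unitTorusGeo L k M) (fun b : Tor (fine n M) × Fin (d + 1) => blockOf n M b.1))
      (mulOp h ∘ₗ (a • (qvAdjRe M n ∘ₗ qvRe M n) + (-landauRe M n)) ∘ₗ mulOp ψ)
      (fun y y' => ind H y * ((|a| * (Real.exp δN * Real.exp δN) + C₁) * Real.exp (-((δN - ρ₁) * gap)) * Real.exp (-(ρ₁ * tdistT M y y')))) := by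
  refine (hasMaj_far_sandwich_out (g := unitTorusGeo L k M) (fun b : Tor (fine n M) × Fin (d + 1) => blockOf n M b.1) (fun b : Tor (fine n M) × Fin (d + 1) => blockOf n M b.1)
    (by positivity) hρ₁ zero_le_one zero_le_one hh1 hhH hψ1 hψA (fun y y' hy hy' => hgap y y' hy hy') (hasMaj_nonlocalPart (L := L) (kk := k) hC₁ hδN hδ hNL)).mono
    fun y y' => le_of_eq ?_
  simp only [one_mul, mul_one]

/-! ## §3 The tail row of one Neumann cube (doubled-cube torus `M_ν = 2S`, any spacing) -/

variable {c : Tor M} {S : ℕ}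

/-- `M_{χ_□}∘M_h = M_h` when `h` lives on blocks of `H ⊆` the cube's blocks. [folklore] -/
theorem mulOp_chiCube_comp_mulOp {h : Tor (fine n M) × Fin (d + 1) → ℝ} {H : Set (Tor M)} (hhH : ∀ x, blockOf n M x.1 ∉ H → h x = 0)
    (hHc : ∀ y, y ∈ H → y ∈ cubeBlocks M c S) : mulOp (chiCube M n c S) ∘ₗ mulOp h = mulOp h := by
  rw [mulOp_comp_mulOp_comm]
  refine mulOp_comp_mulOp_of_support fun x hx => ?_
  have hxH : blockOf n M x.1 ∈ H := by
    by_contra hc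
    exact hx (hhH x hc)
  have hxc : blockOf n M x.1 ∈ cubeBlocks M c S := hHc _ hxH
  unfold chiCube
  rw [if_pos hxc]

/-- ★★★ **THE TAIL ROW OF THE DRESSED SMOOTH-CUT CUBE** (dag-n15-w3 files 44∕45 `hT`, and `hT′` at the fine spacing): on the doubled-cube torus `M_ν = 2S`, at ANY spacing `n`, from the
torus letters `G ≤ Ce^{−δ₀d}` (Prop. 1.2 (1.110)) and `∂Π∂* ≤ C₁e^{−δ₁d}` ((1.126)), a row sum `c_r` at rate `σ`, `0 ≤ ρ ≤ δ₀`, `ρ + σ ≤ ρ₁ ≤ δ_N ≤ δ₁`, and a partition function `|h| ≤ 1`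
on blocks `H ⊆ □`, a bump `χ̃` (`|1 − χ̃| ≤ 1`) with plateau `A ⊇` the `gap`-neighbourhood of `H`:
`(−M_h∘(aQ*Q − ∂Π∂*)∘M_{1−χ̃})∘G(□ + c) ≤ 1_□(y)1_□(y′)·2^{d+1}·(|a|e^{2δ_N} + C₁)e^{−(δ_N−ρ₁)gap}·Ce^{δ₀}c_r·e^{−ρ|y−y′|_T}` — EXPONENTIALLY SMALL IN THE MARGIN.
[cite: Balaban1984PropagatorsII, (2.36)–(2.37) p.229 (Neumann cubes by images), (2.92)–(2.93) p.239 (the `ζ_□` device), (2.133)–(2.134) p.247 (shapes); Balaban1984PropagatorsI, (1.120)–(1.123) p.37, (1.126)–(1.128) p.38; Balaban1985BackgroundPropagators, (3.63)–(3.65) pp.402–403 (mechanism)] -/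
theorem hasMaj_tail_neumannCubeG (hM : ∀ ν, M ν = 2 * S) {a C δ₀ C₁ δ₁ δN ρ₁ ρ σ cr gap : ℝ}
    (htri : Triangle254 (unitTorusGeo L k M)) (hrow : RowSum (unitTorusGeo L k M) σ cr) (hC : 0 ≤ C) (hδ₀ : 0 ≤ δ₀) (hC₁ : 0 ≤ C₁) (hδN : 0 ≤ δN) (hδN₁ : δN ≤ δ₁)
    (hρ₁ : ρ₁ ≤ δN) (hρ : 0 ≤ ρ) (hρδ : ρ ≤ δ₀) (hρσ : ρ + σ ≤ ρ₁)
    (hG : HasMaj (BlockNorm.ofBlocks (unitTorusGeo L k M) (fun b : Tor (fine n M) × Fin (d + 1) => blockOf n M b.1))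
      (BlockNorm.ofBlocks (unitTorusGeo L k M) (fun b : Tor (fine n M) × Fin (d + 1) => blockOf n M b.1)) (gOp M n a) (fun y y' => C * Real.exp (-(δ₀ * tdistT M y y'))))
    (hNL : HasMaj (BlockNorm.ofBlocks (unitTorusGeo L k M) (fun b : Tor (fine n M) × Fin (d + 1) => blockOf n M b.1))
      (BlockNorm.ofBlocks (unitTorusGeo L k M) (fun b : Tor (fine n M) × Fin (d + 1) => blockOf n M b.1)) (landauRe M n) (fun y y' => C₁ * Real.exp (-(δ₁ * tdistT M y y'))))
    {h ψ : Tor (fine n M) × Fin (d + 1) → ℝ} {H A : Set (Tor M)}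
    (hh1 : ∀ x, |h x| ≤ 1) (hhH : ∀ x, blockOf n M x.1 ∉ H → h x = 0) (hHc : ∀ y, y ∈ H → y ∈ cubeBlocks M c S)
    (hψ1 : ∀ x, |ψ x| ≤ 1) (hψA : ∀ x, blockOf n M x.1 ∈ A → ψ x = 0) (hgap : ∀ y y', y ∈ H → y' ∉ A → gap ≤ tdistT M y y') :
    HasMaj (BlockNorm.ofBlocks (unitTorusGeo L k M) (fun b : Tor (fine n M) × Fin (d + 1) => blockOf n M b.1))
      (BlockNorm.ofBlocks (unitTorusGeo L k M) (fun b : Tor (fine n M) × Fin (d + 1) => blockOf n M b.1))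
      ((-(mulOp h ∘ₗ (a • (qvAdjRe M n ∘ₗ qvRe M n) + (-landauRe M n)) ∘ₗ mulOp ψ)) ∘ₗ neumannCubeG M n c S a)
      (fun y y' => ind (cubeBlocks M c S : Set (Tor M)) y * ind (cubeBlocks M c S : Set (Tor M)) y' *
        (2 ^ (d + 1) * ((|a| * (Real.exp δN * Real.exp δN) + C₁) * Real.exp (-((δN - ρ₁) * gap)) * (C * Real.exp δ₀) * cr) * Real.exp (-(ρ * tdistT M y y')))) := by
  have ha₁ : 0 ≤ (|a| * (Real.exp δN * Real.exp δN) + C₁) * Real.exp (-((δN - ρ₁) * gap)) := by positivity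
  -- the sandwich letter, output localization dropped
  have hT₁ : HasMaj (BlockNorm.ofBlocks (unitTorusGeo L k M) (fun b : Tor (fine n M) × Fin (d + 1) => blockOf n M b.1))
      (BlockNorm.ofBlocks (unitTorusGeo L k M) (fun b : Tor (fine n M) × Fin (d + 1) => blockOf n M b.1))
      (mulOp h ∘ₗ (a • (qvAdjRe M n ∘ₗ qvRe M n) + (-landauRe M n)) ∘ₗ mulOp ψ)
      (fun y y' => (|a| * (Real.exp δN * Real.exp δN) + C₁) * Real.exp (-((δN - ρ₁) * gap)) * Real.exp (-(ρ₁ * tdistT M y y'))) := by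
    refine (hasMaj_tailSandwich (L := L) (k := k) (a := a) hC₁ hδN hδN₁ hρ₁ hNL hh1 hhH hψ1 hψA hgap).mono fun y y' => ?_
    have hX : 0 ≤ (|a| * (Real.exp δN * Real.exp δN) + C₁) * Real.exp (-((δN - ρ₁) * gap)) * Real.exp (-(ρ₁ * tdistT M y y')) := by positivity
    calc ind H y * ((|a| * (Real.exp δN * Real.exp δN) + C₁) * Real.exp (-((δN - ρ₁) * gap)) * Real.exp (-(ρ₁ * tdistT M y y')))
        ≤ 1 * ((|a| * (Real.exp δN * Real.exp δN) + C₁) * Real.exp (-((δN - ρ₁) * gap)) * Real.exp (-(ρ₁ * tdistT M y y'))) :=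
          mul_le_mul_of_nonneg_right (ind_le_one _ _) hX
      _ = _ := one_mul _
  have key := hasMaj_chiCube_comp_neumannCubeG (c := c) (S := S) hM htri hrow hC hδ₀ ha₁ hρ hρδ hρσ hT₁ hG
  -- insert the cube's cut behind `M_h` and move the sign out
  have hcut := mulOp_chiCube_comp_mulOp (c := c) (S := S) hhH hHc
  refine key.neg.congr fun μ => ?_
  simp only [LinearMap.neg_apply, LinearMap.comp_apply]
  congr 1
  exact LinearMap.congr_fun hcut _

end Tail

/-! ## §4 Both analytic letters discharged on the lineage's doubled tori, both spacings -/

section Pair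

omit d in
/-- weight bookkeeping: `A ≤ B`, `e ≥ 0` ⟹ `w·w′·(A·e) ≤ w·w′·(B·e)` for nonnegative indicator weights. [folklore] -/
theorem ind_mul_ind_mul_mono {g : B6.Geometry} {S : Set g.Site} {A B e : ℝ} (hAB : A ≤ B) (he : 0 ≤ e) (y y' : g.Site) :
    ind S y * ind S y' * (A * e) ≤ ind S y * ind S y' * (B * e) :=
  mul_le_mul_of_nonneg_left (mul_le_mul_of_nonneg_right hAB he) (mul_nonneg (ind_nonneg _ _) (ind_nonneg _ _))

variable {L : ℕ} [NeZero L]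

/-- ★★★ **THE TAIL ROWS OF THE LINEAGE's NEUMANN CUBES, BOTH SPACINGS, HYPOTHESIS-FREE IN EVERY ANALYTIC LETTER** (dag-n15-w3 files 44∕45 `hT` ∕ `hT′`): for odd `L > 1`, `a > 0`
there are `δ_T, δ_g, c_T > 0` such that on EVERY doubled torus `M_ν = 2L^{m_T} = 2S` of the family (cube side `S` in any spelling: `L^{m_T}`, `L·L^m`, `q·w`), for EVERY `k ≥ 1`, `r`,
cube corner `c`, and EVERY partition function
`|h| ≤ 1` on blocks `H ⊆ □`, collar function `|ψ| ≤ 1` vanishing on the plateau blocks `A` (`ψ = 1 − χ̃` for the bump `χ̃`), `|y − y′|_T ≥ gap` for `y ∈ H`, `y′ ∉ A`: at the spacing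
`L^k` AND at the spacing `L^r·L^k`, `(−M_h∘(aQ*Q − ∂Π∂*)∘M_ψ)∘G(□ + c) ≤ 1_□(y)1_□(y′)·c_T e^{−δ_g·gap}·e^{−δ_T|y−y′|_T}`.  Letters: [B5] Prop. 1.2 (1.110) at `U ≡ 1` (`ineq110_114_pair`,
`hasMaj_gOp_of_ineq`), (1.126) (`hasMaj_landauRe`), (2.61) row sums (`rowSum_unitTorusGeo`).
[cite: Balaban1984PropagatorsI, Prop. 1.2 (1.110) p.35, (1.126) p.38; Balaban1984PropagatorsII, (2.36)–(2.37) p.229, Lemma 2.1 (2.61) p.234, (2.92)–(2.93) p.239, (2.133)–(2.134) p.247; Balaban1985BackgroundPropagators, (3.63)–(3.65) pp.402–403 (mechanism)] -/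
theorem hasMaj_tail_neumannCubeG_pair (hL : Odd L ∧ 1 < L) {a : ℝ} (ha : 0 < a) :
    ∃ δT δg cT : ℝ, 0 < δT ∧ 0 < δg ∧ 0 < cT ∧ ∀ (mT k r : ℕ) (hk : 1 ≤ k) (S : ℕ) (hS : ∀ ν, MP (paramsOf d L mT k hL) ν = 2 * S)
      (c : Tor (MP (paramsOf d L mT k hL))) (H A : Set (Tor (MP (paramsOf d L mT k hL)))) (gap : ℝ),
      (∀ y, y ∈ H → y ∈ cubeBlocks (MP (paramsOf d L mT k hL)) c S) →
      (∀ y y', y ∈ H → y' ∉ A → gap ≤ tdistT (MP (paramsOf d L mT k hL)) y y') →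
      (∀ (h ψ : Tor (fine (L ^ k) (MP (paramsOf d L mT k hL))) × Fin (d + 1) → ℝ),
        (∀ x, |h x| ≤ 1) → (∀ x, blockOf (L ^ k) (MP (paramsOf d L mT k hL)) x.1 ∉ H → h x = 0) →
        (∀ x, |ψ x| ≤ 1) → (∀ x, blockOf (L ^ k) (MP (paramsOf d L mT k hL)) x.1 ∈ A → ψ x = 0) →
        HasMaj (BlockNorm.ofBlocks (unitTorusGeo L k (MP (paramsOf d L mT k hL))) (blkFine L k (MP (paramsOf d L mT k hL))))
          (BlockNorm.ofBlocks (unitTorusGeo L k (MP (paramsOf d L mT k hL))) (blkFine L k (MP (paramsOf d L mT k hL))))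
          ((-(mulOp h ∘ₗ (a • (qvAdjRe (MP (paramsOf d L mT k hL)) (L ^ k) ∘ₗ qvRe (MP (paramsOf d L mT k hL)) (L ^ k)) + (-landauRe (MP (paramsOf d L mT k hL)) (L ^ k))) ∘ₗ
              mulOp ψ)) ∘ₗ neumannCubeG (MP (paramsOf d L mT k hL)) (L ^ k) c S a)
          (fun y y' => ind ((cubeBlocks (MP (paramsOf d L mT k hL)) c S : Finset _) : Set _) y *
            ind ((cubeBlocks (MP (paramsOf d L mT k hL)) c S : Finset _) : Set _) y' *
            (cT * Real.exp (-(δg * gap)) * Real.exp (-(δT * tdistT (MP (paramsOf d L mT k hL)) y y'))))) ∧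
      (∀ (h ψ : Tor (fine (L ^ r * L ^ k) (MP (paramsOf d L mT k hL))) × Fin (d + 1) → ℝ),
        (∀ x, |h x| ≤ 1) → (∀ x, blockOf (L ^ r * L ^ k) (MP (paramsOf d L mT k hL)) x.1 ∉ H → h x = 0) →
        (∀ x, |ψ x| ≤ 1) → (∀ x, blockOf (L ^ r * L ^ k) (MP (paramsOf d L mT k hL)) x.1 ∈ A → ψ x = 0) →
        HasMaj (BlockNorm.ofBlocks (unitTorusGeo L k (MP (paramsOf d L mT k hL)))
            (fun i : Tor (fine (L ^ r * L ^ k) (MP (paramsOf d L mT k hL))) × Fin (d + 1) => blockOf (L ^ r * L ^ k) (MP (paramsOf d L mT k hL)) i.1))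
          (BlockNorm.ofBlocks (unitTorusGeo L k (MP (paramsOf d L mT k hL)))
            (fun i : Tor (fine (L ^ r * L ^ k) (MP (paramsOf d L mT k hL))) × Fin (d + 1) => blockOf (L ^ r * L ^ k) (MP (paramsOf d L mT k hL)) i.1))
          ((-(mulOp h ∘ₗ (a • (qvAdjRe (MP (paramsOf d L mT k hL)) (L ^ r * L ^ k) ∘ₗ qvRe (MP (paramsOf d L mT k hL)) (L ^ r * L ^ k)) +
              (-landauRe (MP (paramsOf d L mT k hL)) (L ^ r * L ^ k))) ∘ₗ mulOp ψ)) ∘ₗ neumannCubeG (MP (paramsOf d L mT k hL)) (L ^ r * L ^ k) c S a)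
          (fun y y' => ind ((cubeBlocks (MP (paramsOf d L mT k hL)) c S : Finset _) : Set _) y *
            ind ((cubeBlocks (MP (paramsOf d L mT k hL)) c S : Finset _) : Set _) y' *
            (cT * Real.exp (-(δg * gap)) * Real.exp (-(δT * tdistT (MP (paramsOf d L mT k hL)) y y'))))) := by
  obtain ⟨δ₀, C, Cα, Cε, Cαε, hδ₀, hC, HG⟩ := ineq110_114_pair (d := d) hL ha
  obtain ⟨δ₁, C₁, hδ₁, hC₁, HN⟩ := hasMaj_landauRe (d := d) (L := L)
  -- rates: `δ_m = min δ₀ δ₁`, row sum at `σ = δ_m∕4`, `ρ = δ_m∕4`, `ρ₁ = δ_m∕2`, `δ_N = δ_m`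
  obtain ⟨δm, hδm⟩ : ∃ δm : ℝ, δm = min δ₀ δ₁ := ⟨_, rfl⟩
  have hδm0 : 0 < δm := by rw [hδm]; exact lt_min hδ₀ hδ₁
  have hδm₀ : δm ≤ δ₀ := by rw [hδm]; exact min_le_left _ _
  have hδm₁ : δm ≤ δ₁ := by rw [hδm]; exact min_le_right _ _
  obtain ⟨cr, hcr⟩ : ∃ cr : ℝ, cr = B4Sect5Proof.latticeConst (d + 1) (δm / 4) := ⟨_, rfl⟩
  have hcr0 : 0 ≤ cr := by
    have h := (rowSum_unitTorusGeo L 0 (MP (paramsOf d L 0 0 hL)) (by positivity : 0 < δm / 4)).nonneg (fun _ => 0)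
    rw [hcr]; exact h
  have hcN : 0 ≤ 2 ^ (d + 1) * ((|a| * (Real.exp δm * Real.exp δm) + C₁) * (C * Real.exp δ₀) * cr) := by positivity
  refine ⟨δm / 4, δm / 2, 2 ^ (d + 1) * ((|a| * (Real.exp δm * Real.exp δm) + C₁) * (C * Real.exp δ₀) * cr) + 1, by positivity, by positivity, by positivity,
    fun mT k r hk S hS c H A gap hHc hgap => ?_⟩
  have htri := triangle254_unitTorusGeo L k (MP (paramsOf d L mT k hL))
  have hrow : RowSum (unitTorusGeo L k (MP (paramsOf d L mT k hL))) (δm / 4) cr := by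
    rw [hcr]; exact rowSum_unitTorusGeo L k (MP (paramsOf d L mT k hL)) (by positivity : 0 < δm / 4)
  have hρσ : δm / 4 + δm / 4 ≤ δm / 2 := by linarith
  have hρ₁ : δm / 2 ≤ δm := by linarith
  have hgap' : δm - δm / 2 = δm / 2 := by ring
  -- the weight comparison shared by both spacings
  have hAB : 2 ^ (d + 1) * ((|a| * (Real.exp δm * Real.exp δm) + C₁) * Real.exp (-(δm / 2 * gap)) * (C * Real.exp δ₀) * cr) ≤
      (2 ^ (d + 1) * ((|a| * (Real.exp δm * Real.exp δm) + C₁) * (C * Real.exp δ₀) * cr) + 1) * Real.exp (-(δm / 2 * gap)) := by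
    have hE : 0 ≤ Real.exp (-(δm / 2 * gap)) := Real.exp_nonneg _
    nlinarith [mul_nonneg hcN hE]
  refine ⟨fun h ψ hh1 hhH hψ1 hψA => ?_, fun h ψ hh1 hhH hψ1 hψA => ?_⟩
  · have hn : 1 ≤ L ^ k := Nat.one_le_pow _ _ (Nat.pos_of_ne_zero (NeZero.ne L))
    have hG := hasMaj_gOp_of_ineq (L := L) (k := k) _ _ a hn (HG mT k r hk).1 hC.le
    have hNL := HN k (L ^ k) (MP (paramsOf d L mT k hL))
    refine (hasMaj_tail_neumannCubeG (L := L) (k := k) (c := c) (S := S) hS htri hrow hC.le hδ₀.le hC₁.le hδm0.le hδm₁ hρ₁ (by positivity) (by linarith) hρσ hG hNL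
      hh1 hhH hHc hψ1 hψA hgap).mono fun y y' => ?_
    rw [hgap']
    exact ind_mul_ind_mul_mono hAB (Real.exp_nonneg _) y y'
  · have hn' : 1 ≤ L ^ r * L ^ k := Nat.one_le_iff_ne_zero.mpr (Nat.mul_ne_zero (pow_ne_zero r (NeZero.ne L)) (pow_ne_zero k (NeZero.ne L)))
    haveI : NeZero (L ^ r * L ^ k) := ⟨by positivity⟩
    have hG := hasMaj_gOp_of_ineq (L := L) (k := k) _ _ a hn' (HG mT k r hk).2 hC.le
    have hNL := HN k (L ^ r * L ^ k) (MP (paramsOf d L mT k hL))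
    refine (hasMaj_tail_neumannCubeG (L := L) (k := k) (c := c) (S := S) hS htri hrow hC.le hδ₀.le hC₁.le hδm0.le hδm₁ hρ₁ (by positivity) (by linarith) hρσ hG hNL
      hh1 hhH hHc hψ1 hψA hgap).mono fun y y' => ?_
    rw [hgap']
    exact ind_mul_ind_mul_mono hAB (Real.exp_nonneg _) y y'

end Pair

end Summit.QuantumFields.YangMills.BalabanUVNodes.N15.TwoGrid

end
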